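import Mathlib
import HarnessLib
import Literature.Analysis.FluidPDE.DirectionDissipation
import Literature.Analysis.FluidPDE.ESSLocalHolderBlowupLimit
import Literature.Analysis.FluidPDE.KNSSTypeIRateMildProofs
import Literature.Analysis.FluidPDE.LerayHopfNSRescale
import Literature.Analysis.FluidPDE.SpaceTimeRescaling
import Summits.NavierStokesRegularity.NavierStokesRegularity.Theorems.LocalSineTubeDoorLocalPointZoomFrame
import Summits.NavierStokesRegularity.NavierStokesRegularity.Theorems.LocalSineTubeDoorLocalPointZoomCurl

/-!
# Route `LocalSineTubeDoor`, crux `LocalPointZoom` (stmt-NavierStokesRegularity-20017) — the ALL-SLICES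
# strengthening `localPointZoomSlices` (= the staged PoloidalWindowDoor crux `LocalPointZoomSlices`)

Cell ns-regularity-ideate, seat p6 (`--supports stmt-NavierStokesRegularity-20017`).  Local version of the
cell's kernel theorem `Cell.NsRegP1c.pointZoomLimitSlices_holds` (Sketch7A/8A, global Type I): at a LOCALLY
Type I, non-backward-bounded point the zoom-in profile of `localTreeZoomFrame` attracts the rescaled
vorticities on EVERY interior slice `s < 0`, not only `s = −1`:

* `rate_smul_stPull`, `cont_smul_stPull`, `mild_smul_stPull` — the Type-I rate, continuity on the open
  slab and the unit-viscosity Oseen-mild identity of the route's profile class are invariant under the Navier–Stokes scaling `v ↦ σ • v(σ²·, σ·)` about the apex (tree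
  `HasTypeITimeDecay.nsRescale`, `oseen_smul_stPull`);
* `localPointZoomSlices` — parabolic scaling covariance: for `σ = √(−s)` the frame `(v', π', λⱼ, w, v₁)`
  rescales to `(v', π', σλⱼ, σ•w∘Φ_σ, σ•v₁∘Φ_σ)` (`zoom_zoom`, `eLpNorm_uncurry_zoom`,
  `ae_eq_restrict_comp_stAffine`) and `localZoomFrame_curl_tendsto` at time `−1` of the rescaled frame is
  the convergence at time `s`.  Its statement is VERBATIM the `LocalPointZoomSlices` crux of the staged
  route PoloidalWindowDoor (nsreg-p1, route-poloidal/Route.md), so that crux is closed by `exact` once born;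
  restricted to `s = −1` it re-proves `LocalPointZoom`.

WHAT THIS IS NOT: not a claim about Navier–Stokes regularity; a support theorem for DRAFT/staged door routes.
-/

noncomputable section

namespace Summit.NavierStokesRegularity.NavierStokesRegularity.Theorems.LocalSineTubeDoorLocalPointZoomSlices

open MeasureTheory Set Function Filter Topology TopologicalSpace Metric
open Literature.Analysis Literature.Analysis.FluidPDE Literature.Analysis.FluidPDE.SereginSverak2009
open Summit.NavierStokesRegularity.NavierStokesRegularity.Theorems
open Summit.NavierStokesRegularity.NavierStokesRegularity.Theorems.LocalSineTubeDoorLocalPointZoomFrame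
open Summit.NavierStokesRegularity.NavierStokesRegularity.Theorems.LocalSineTubeDoorLocalPointZoomCurl
open scoped NNReal ENNReal

/-- The Type-I rate is invariant under the Navier–Stokes scaling `v ↦ σ • v(σ² ·, σ ·)` about the apex. -/
theorem rate_smul_stPull {C : ℝ} {v : ℝ → (EuclideanSpace ℝ (Fin 3)) → (EuclideanSpace ℝ (Fin 3))} (hrate : HasTypeITimeDecay C v) {σ : ℝ} (hσ : 0 < σ) :
    HasTypeITimeDecay C (σ • stPull (σ ^ 2) σ (0 : ℝ) (0 : (EuclideanSpace ℝ (Fin 3))) v) := by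
  have h := hrate.nsRescale hσ
  rwa [nsRescale_eq_smul_stPull] at h

/-- Continuity on the open slab is invariant under the Navier–Stokes scaling about the apex. -/
theorem cont_smul_stPull {v : ℝ → (EuclideanSpace ℝ (Fin 3)) → (EuclideanSpace ℝ (Fin 3))} (hcont : ContinuousOn (uncurry v) (Iio (0 : ℝ) ×ˢ univ))
    {σ : ℝ} (hσ : 0 < σ) :
    ContinuousOn (uncurry (σ • stPull (σ ^ 2) σ (0 : ℝ) (0 : (EuclideanSpace ℝ (Fin 3))) v)) (Iio (0 : ℝ) ×ˢ univ) := by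
  have hΦc : Continuous (stAffine (σ ^ 2) σ (0 : ℝ) (0 : (EuclideanSpace ℝ (Fin 3)))) := continuous_stAffine _ _ _ _
  have hmaps : MapsTo (stAffine (σ ^ 2) σ (0 : ℝ) (0 : (EuclideanSpace ℝ (Fin 3)))) (Iio (0 : ℝ) ×ˢ univ)
      (Iio (0 : ℝ) ×ˢ univ) := by
    intro z hz
    obtain ⟨h1, -⟩ := mem_prod.1 hz
    refine mem_prod.2 ⟨?_, mem_univ _⟩
    simp only [mem_Iio, stAffine_fst] at h1 ⊢
    have : σ ^ 2 * z.1 < 0 := mul_neg_of_pos_of_neg (pow_pos hσ 2) h1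
    linarith
  have h1 : uncurry (σ • stPull (σ ^ 2) σ (0 : ℝ) (0 : (EuclideanSpace ℝ (Fin 3))) v) =
      fun z => σ • (uncurry v ∘ stAffine (σ ^ 2) σ (0 : ℝ) (0 : (EuclideanSpace ℝ (Fin 3)))) z := by
    funext z; rfl
  rw [h1]
  exact (hcont.comp hΦc.continuousOn hmaps).const_smul σ

/-- The unit-viscosity Oseen (mild) identity between negative times is invariant under the Navier–Stokes
scaling about the apex (tree `oseen_smul_stPull`). -/
theorem mild_smul_stPull {v : ℝ → (EuclideanSpace ℝ (Fin 3)) → (EuclideanSpace ℝ (Fin 3))}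
    (hmild : ∀ s t : ℝ, s < t → t < 0 → ∀ x,
      v t x = UnboundedOperators.heatExtension (v s) (t - s) x - oseenDuhamel 1 s v v t x)
    {σ : ℝ} (hσ : 0 < σ) :
    ∀ s t : ℝ, s < t → t < 0 → ∀ x, (σ • stPull (σ ^ 2) σ (0 : ℝ) (0 : (EuclideanSpace ℝ (Fin 3))) v) t x =
      UnboundedOperators.heatExtension ((σ • stPull (σ ^ 2) σ (0 : ℝ) (0 : (EuclideanSpace ℝ (Fin 3))) v) s) (t - s) x -
        oseenDuhamel 1 s (σ • stPull (σ ^ 2) σ (0 : ℝ) (0 : (EuclideanSpace ℝ (Fin 3))) v) (σ • stPull (σ ^ 2) σ (0 : ℝ) (0 : (EuclideanSpace ℝ (Fin 3))) v) t x := by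
  intro s t hst ht y
  have hσ2 : 0 < σ ^ 2 := pow_pos hσ 2
  have hs' : (0 : ℝ) + σ ^ 2 * s < 0 + σ ^ 2 * t := by nlinarith
  have ht' : (0 : ℝ) + σ ^ 2 * t < 0 := by nlinarith
  exact oseen_smul_stPull hσ 0 0 hst (fun X => hmild _ _ hs' ht' X) y

/-- **LOCAL POINT ZOOM LIMIT WITH SLICES** (the text of the staged PoloidalWindowDoor crux
`LocalPointZoomSlices` = item `LocalPointZoom` of route LocalSineTubeDoor with vorticity convergence on ALL
interior slices `s < 0`): parabolic scaling covariance of the local tree zoom frame — for `σ = √(−s)` the frame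
`(v', π', λⱼ, w, v₁)` of `localTreeZoomFrame` rescales to `(v', π', σλⱼ, σ•w∘Φ_σ, σ•v₁∘Φ_σ)`, and
`localZoomFrame_curl_tendsto` at the interior time `−1` of the rescaled frame is the vorticity convergence at
time `s` of the original one. -/
theorem localPointZoomSlices :
    ∀ (ν T : ℝ), 0 < ν → 0 < T → ∀ (u : ℝ → EuclideanSpace ℝ (Fin 3) → EuclideanSpace ℝ (Fin 3))
      (p : ℝ → EuclideanSpace ℝ (Fin 3) → ℝ),
    Literature.Analysis.FluidPDE.IsClassicalNSSolutionOn (Set.Ico 0 T) ν 0 u p →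
    Literature.Analysis.FluidPDE.IsLerayHopfOn T ν 0 (u 0) u →
    Literature.Analysis.FluidPDE.HasRapidSpatialDecay (u 0) →
    ∀ (x₀ : EuclideanSpace ℝ (Fin 3)) (ρ M : ℝ), 0 < ρ →
    (∀ t ∈ Set.Ico 0 T, T - ρ ^ 2 < t → ∀ x ∈ Metric.ball x₀ ρ, ‖u t x‖ * Real.sqrt (ν * (T - t)) ≤ M) →
    ¬ Literature.Analysis.FluidPDE.IsBackwardBoundedAt u T x₀ →
    ∃ (C : ℝ) (v : ℝ → EuclideanSpace ℝ (Fin 3) → EuclideanSpace ℝ (Fin 3)) (lam : ℕ → ℝ),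
      (∀ j, 0 < lam j) ∧ Filter.Tendsto lam Filter.atTop (nhds 0) ∧
      (Literature.Analysis.FluidPDE.HasTypeITimeDecay C v ∧
        ContinuousOn (Function.uncurry v) (Set.Iio (0 : ℝ) ×ˢ Set.univ) ∧
        (∀ s t : ℝ, s < t → t < 0 → ∀ x, v t x =
          Literature.Analysis.UnboundedOperators.heatExtension (v s) (t - s) x -
            Literature.Analysis.FluidPDE.oseenDuhamel 1 s v v t x) ∧
        (∀ t < 0, Literature.Analysis.FluidPDE.VectorCalculus.IsDivFree (v t))) ∧
      Literature.Analysis.FluidPDE.IsBackwardSingularPoint v 0 ∧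
      ∀ s < 0, ∀ y, Filter.Tendsto (fun j => (lam j ^ 2 / ν) •
        Literature.Analysis.FluidPDE.curl (u (T + lam j ^ 2 * s / ν)) (x₀ + lam j • y)) Filter.atTop
        (nhds (Literature.Analysis.FluidPDE.curl (v s) y)) := by
  intro ν T hν hT u p hsol hLH _ x₀ ρ M hρ hM hnotbd
  obtain ⟨R, C₁, v', π', lam, w, v₁, Ks, r₁, hR, hlam, hlam0, hball1, hr₁, hr₁1, hKs, hL3, hae, hP,
    hsing₁, hpt⟩ := localTreeZoomFrame hν hT hsol hLH hρ hM hnotbd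
  refine ⟨C₁, v₁, fun j => R * (lam j / 2), fun j => mul_pos hR (half_pos (hlam j)),
    by simpa using (hlam0.div_const 2).const_mul R, hP, hsing₁, fun s hs y => ?_⟩
  -- ## the scaling factor `σ = √(−s)`
  have hns : 0 < -s := neg_pos.2 hs
  set σ : ℝ := Real.sqrt (-s) with hσdef
  have hσ : 0 < σ := Real.sqrt_pos.2 hns
  have hσ2 : σ ^ 2 = -s := Real.sq_sqrt hns.le
  have hσne : σ ≠ 0 := hσ.ne'
  -- ## the rescaled frame
  set lam' : ℕ → ℝ := fun j => σ * lam j with hlam'def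
  have hlam' : ∀ j, 0 < lam' j := fun j => mul_pos hσ (hlam j)
  have hlam0' : Tendsto lam' atTop (𝓝 0) := by
    show Tendsto (fun j => σ * lam j) atTop (𝓝 0)
    simpa using hlam0.const_mul σ
  set w' : ℝ → (EuclideanSpace ℝ (Fin 3)) → (EuclideanSpace ℝ (Fin 3)) := σ • stPull (σ ^ 2) σ (0 : ℝ) (0 : (EuclideanSpace ℝ (Fin 3))) w with hw'def
  set v₁' : ℝ → (EuclideanSpace ℝ (Fin 3)) → (EuclideanSpace ℝ (Fin 3)) := σ • stPull (σ ^ 2) σ (0 : ℝ) (0 : (EuclideanSpace ℝ (Fin 3))) v₁ with hv₁'def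
  have hZZ : ∀ j, (lam' j) • stPull ((lam' j) ^ 2) (lam' j) (0 : ℝ) (0 : (EuclideanSpace ℝ (Fin 3))) v' =
      σ • stPull (σ ^ 2) σ (0 : ℝ) (0 : (EuclideanSpace ℝ (Fin 3)))
        ((lam j) • stPull ((lam j) ^ 2) (lam j) (0 : ℝ) (0 : (EuclideanSpace ℝ (Fin 3))) v') := by
    intro j
    simp only [hlam'def]
    rw [zoom_zoom]
  -- (pt') identification with the zooms of `u` at the scales `R σλⱼ/2`
  have hpt' : ∀ (j : ℕ) (s' : ℝ) (y' : (EuclideanSpace ℝ (Fin 3))),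
      ((lam' j) • stPull ((lam' j) ^ 2) (lam' j) (0 : ℝ) (0 : (EuclideanSpace ℝ (Fin 3))) v') s' y' =
        ((R * (lam' j / 2)) / ν) • u (T + (R * (lam' j / 2)) ^ 2 * s' / ν) (x₀ + (R * (lam' j / 2)) • y') := by
    intro j s' y'
    have h := hpt j (σ ^ 2 * s') (σ • y')
    simp only [smul_stPull_apply, zero_add] at h ⊢
    simp only [hlam'def]
    rw [show (σ * lam j) ^ 2 * s' = lam j ^ 2 * (σ ^ 2 * s') by ring,
      show (σ * lam j) • y' = lam j • σ • y' by rw [smul_smul, mul_comm],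
      mul_smul, h, smul_smul, smul_smul,
      show σ * (R * (lam j / 2) / ν) = R * (σ * lam j / 2) / ν by ring,
      show T + (R * (lam j / 2)) ^ 2 * (σ ^ 2 * s') / ν = T + (R * (σ * lam j / 2)) ^ 2 * s' / ν by ring,
      show R * (lam j / 2) * σ = R * (σ * lam j / 2) by ring]
  -- (L3') local `L³` convergence of the rescaled zooms to `w'`
  have hus : ∀ f g : ℝ → (EuclideanSpace ℝ (Fin 3)) → (EuclideanSpace ℝ (Fin 3)), uncurry (f - g) = uncurry f - uncurry g := fun f g => rfl
  have hL3' : ∀ a : ℝ, 0 < a → Tendsto (fun j => eLpNorm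
      (uncurry ((lam' j) • stPull ((lam' j) ^ 2) (lam' j) (0 : ℝ) (0 : (EuclideanSpace ℝ (Fin 3))) v') - uncurry w') 3
      (volume.restrict (parabolicCylinder a (0 : ℝ × (EuclideanSpace ℝ (Fin 3)))))) atTop (𝓝 0) := by
    intro a ha
    have hdiff : ∀ j, uncurry ((lam' j) • stPull ((lam' j) ^ 2) (lam' j) (0 : ℝ) (0 : (EuclideanSpace ℝ (Fin 3))) v') -
        uncurry w' = uncurry (σ • stPull (σ ^ 2) σ (0 : ℝ) (0 : (EuclideanSpace ℝ (Fin 3)))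
          ((lam j) • stPull ((lam j) ^ 2) (lam j) (0 : ℝ) (0 : (EuclideanSpace ℝ (Fin 3))) v' - w)) := by
      intro j
      rw [hZZ j]
      funext z
      obtain ⟨s', y'⟩ := z
      simp only [hw'def, uncurry_apply_pair, Pi.sub_apply, smul_stPull_apply, smul_sub]
    have hconst : (‖σ‖ₑ * (ENNReal.ofReal ((σ ^ 2 * σ ^ 3)⁻¹)) ^ (1 / (3 : ℝ≥0∞).toReal)) ≠ ⊤ :=
      ENNReal.mul_ne_top enorm_ne_top
        (ENNReal.rpow_ne_top_of_nonneg (one_div_nonneg.2 ENNReal.toReal_nonneg) ENNReal.ofReal_ne_top)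
    have key := ENNReal.Tendsto.const_mul (hL3 (a * σ) (mul_pos ha hσ)) (Or.inr hconst)
    rw [mul_zero] at key
    refine key.congr fun j => ?_
    rw [hdiff j]
    conv_rhs => rw [show a = a * σ / σ by field_simp]
    rw [eLpNorm_uncurry_zoom hσ σ _ (a * σ) three_ne_zero ENNReal.ofNat_ne_top, hus]
  -- (ae') the rescaled limit agrees a.e. with the rescaled profile
  have hslab : stAffine (σ ^ 2) σ (0 : ℝ) (0 : (EuclideanSpace ℝ (Fin 3))) ⁻¹' (Iio (0 : ℝ) ×ˢ (univ : Set (EuclideanSpace ℝ (Fin 3)))) =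
      Iio (0 : ℝ) ×ˢ (univ : Set (EuclideanSpace ℝ (Fin 3))) := by
    ext z
    simp only [mem_preimage, mem_prod, mem_Iio, mem_univ, and_true, stAffine_fst, zero_add]
    exact ⟨fun h => neg_of_mul_neg_right h (pow_pos hσ 2).le,
      fun h => mul_neg_of_pos_of_neg (pow_pos hσ 2) h⟩
  have hae' : ∀ᵐ x ∂(volume.restrict (Iio (0 : ℝ) ×ˢ (univ : Set (EuclideanSpace ℝ (Fin 3))))),
      uncurry w' x = uncurry v₁' x := by
    have h := ae_eq_restrict_comp_stAffine (f := uncurry w) (g := uncurry v₁) (pow_pos hσ 2) hσ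
      (0 : ℝ) (0 : (EuclideanSpace ℝ (Fin 3))) hae
    rw [hslab] at h
    filter_upwards [h] with z hz
    show σ • uncurry w (stAffine (σ ^ 2) σ (0 : ℝ) (0 : (EuclideanSpace ℝ (Fin 3))) z) =
      σ • uncurry v₁ (stAffine (σ ^ 2) σ (0 : ℝ) (0 : (EuclideanSpace ℝ (Fin 3))) z)
    rw [show uncurry w (stAffine (σ ^ 2) σ (0 : ℝ) (0 : (EuclideanSpace ℝ (Fin 3))) z) =
      uncurry v₁ (stAffine (σ ^ 2) σ (0 : ℝ) (0 : (EuclideanSpace ℝ (Fin 3))) z) from hz]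
  -- (P') the rescaled profile is in the class (scaling invariance of rate / continuity / mildness)
  have hrate' : HasTypeITimeDecay C₁ v₁' := rate_smul_stPull hP.1 hσ
  have hcont' : ContinuousOn (uncurry v₁') (Iio (0 : ℝ) ×ˢ univ) := cont_smul_stPull hP.2.1 hσ
  have hmild' := mild_smul_stPull hP.2.2.1 hσ
  -- ## the interior upgrade at time `−1` of the rescaled frame
  have key := localZoomFrame_curl_tendsto hν hT hsol.smooth_velocity.continuousOn hρ hM hR hball1 hlam'
    hlam0' hr₁ hr₁1 hKs hpt' hL3' hae' hrate' hcont' hmild' (σ⁻¹ • y)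
  -- ## identification of the terms
  have hcurlZ : ∀ j, curl (((lam' j) • stPull ((lam' j) ^ 2) (lam' j) (0 : ℝ) (0 : (EuclideanSpace ℝ (Fin 3))) v') (-1))
      (σ⁻¹ • y) = (-s) • (((R * (lam j / 2)) ^ 2 / ν) •
        curl (u (T + (R * (lam j / 2)) ^ 2 * s / ν)) (x₀ + (R * (lam j / 2)) • y)) := by
    intro j
    have hfun : ((lam' j) • stPull ((lam' j) ^ 2) (lam' j) (0 : ℝ) (0 : (EuclideanSpace ℝ (Fin 3))) v') (-1) =
        (((R * (lam' j / 2)) / ν) • stPull ((R * (lam' j / 2)) ^ 2 / ν) (R * (lam' j / 2)) T x₀ u)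
          (-1) := by
      funext y'
      rw [hpt' j (-1) y', smul_stPull_apply]
      congr 2
      ring
    have e1 : R * (σ * lam j / 2) / ν * (R * (σ * lam j / 2)) = (-s) * ((R * (lam j / 2)) ^ 2 / ν) := by
      rw [← hσ2]; ring
    have e2 : T + (R * (σ * lam j / 2)) ^ 2 / ν * (-1) = T + (R * (lam j / 2)) ^ 2 * s / ν := by
      have hs' : s = -σ ^ 2 := by rw [hσ2]; ring
      rw [hs']; ring
    have e3 : R * (σ * lam j / 2) * σ⁻¹ = R * (lam j / 2) := by
      calc R * (σ * lam j / 2) * σ⁻¹ = R * (lam j / 2) * (σ * σ⁻¹) := by ring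
        _ = R * (lam j / 2) := by rw [mul_inv_cancel₀ hσne, mul_one]
    rw [hfun, curl_smul_stPull]
    simp only [hlam'def, smul_smul]
    rw [e1, e2, e3]
  have hlimit : curl (v₁' (-1)) (σ⁻¹ • y) = (-s) • curl (v₁ s) y := by
    simp only [hv₁'def]
    rw [curl_smul_stPull]
    simp only [smul_smul, mul_inv_cancel₀ hσne, one_smul, zero_add]
    rw [show σ ^ 2 * (-1) = s by rw [hσ2]; ring, show σ * σ = -s by rw [← hσ2]; ring]
  -- ## conclusion: divide by `−s`
  have key' : Tendsto (fun j => (-s) • (((R * (lam j / 2)) ^ 2 / ν) •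
      curl (u (T + (R * (lam j / 2)) ^ 2 * s / ν)) (x₀ + (R * (lam j / 2)) • y))) atTop
      (𝓝 ((-s) • curl (v₁ s) y)) := by
    rw [← hlimit]
    exact Tendsto.congr hcurlZ key
  have key3 := key'.const_smul (-s)⁻¹
  simp only [smul_smul, inv_mul_cancel₀ hns.ne', inv_mul_cancel_left₀ hns.ne', one_smul]
    at key3
  exact key3


end Summit.NavierStokesRegularity.NavierStokesRegularity.Theorems.LocalSineTubeDoorLocalPointZoomSlices

end
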